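import Summits.Ventures.Crystal3D.Theorems.StickyWulffConstantNoReconstructionGainRegistry
import Summits.Ventures.Crystal3D.Theorems.StickyWulffConstantNoReconstructionGainLatticeAdhesion
import HarnessLib

/-!
# The slot sum: the deficiency of a finite piece of `Λ₀` is half the number of its empty slots,
# `D(P) = ½ Σ_{w ∈ twelve slots} #{p ∈ P : p + w ∉ P}`

HONEST FRAMING. Part of the venture `Summits/Ventures/Crystal3D` (cell `crystal3d-full`), helper for the
crux `GenericWallFloor` (stmt-Ventures-19480) of `route-Ventures-StickyWulffConstant`, line `WallLedgerG`:
modules M1 (upper slab count) and M2 (the slot ledger) of the rigid-bicrystal rung of `stub_twoSlabAdhesion`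
(note RIGID-RUNG-ARCH on the item) both start from this identity.  Pure bookkeeping on
`Λ₀ = fccStacking 1 √(2/3)`; nothing about ground states.

* `fccSlots` — the twelve bond vectors of `Λ₀` as a `Finset` (image of the twelve coordinate triples
  under `barlowPos`), `card_fccSlots = 12`, `norm_eq_one_of_mem_fccSlots`, `add_mem_fcc_of_mem_fccSlots`,
  `sub_mem_fccSlots_of_dist_eq_one` (two sites at distance `1` differ by a slot; `fcc_unit_directions`).
* `card_contacts_eq_card_occupied_slots` — for `p ∈ Λ₀` and `P ⊆ Λ₀`:
  `#{q ∈ P : dist p q = 1} = #{w ∈ fccSlots : p + w ∈ P}`.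
* `contactDeficiency_eq_half_sum_card_empty` — **`D(P) = ½ Σ_{w} #{p ∈ P : p + w ∉ P}`** for finite `P ⊆ Λ₀`.

WHAT THIS IS NOT: no geometry of the sample; rung F-C1 not moved.
-/

noncomputable section

namespace Summit.Ventures.Crystal3D.Theorems

open Summit.Ventures.Crystal3D Finset
open Literature.MathematicalPhysics.StatisticalMechanics (barlowPos fccStacking constHagg haggLabel_const
  barlowPos_mem orderedContacts contactDeficiency)

/-- The twelve coordinate triples `(k, i, j)` of the bond vectors of `Λ₀`. -/
def fccSlotTriples : Finset (ℤ × ℤ × ℤ) :=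
  {(0, 1, 0), (0, 0, 1), (1, 0, 0), (0, 1, -1), (-1, 1, 0), (-1, 0, 1),
   (0, -1, 0), (0, 0, -1), (-1, 0, 0), (0, -1, 1), (1, -1, 0), (1, 0, -1)}

/-- **The twelve slots** (bond vectors) of `Λ₀ = fccStacking 1 √(2/3)`. -/
def fccSlots : Finset (EuclideanSpace ℝ (Fin 3)) :=
  fccSlotTriples.image fun c => barlowPos 1 (Real.sqrt (2 / 3)) constHagg c.1 c.2.1 c.2.2

/-- There are exactly twelve slots. -/
theorem card_fccSlots : fccSlots.card = 12 := by
  classical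
  rw [fccSlots, card_image_of_injOn]
  · decide
  · intro c _ c' _ h
    have := barlowPos_fcc_injective h
    simp only [Prod.mk.injEq] at this
    exact Prod.ext this.1 (Prod.ext this.2.1 this.2.2)

/-- Every slot is a unit vector. -/
theorem norm_eq_one_of_mem_fccSlots {w : EuclideanSpace ℝ (Fin 3)} (hw : w ∈ fccSlots) : ‖w‖ = 1 := by
  rw [fccSlots, mem_image] at hw
  obtain ⟨c, hc, rfl⟩ := hw
  simp only [fccSlotTriples, mem_insert, mem_singleton] at hc
  rcases hc with rfl | rfl | rfl | rfl | rfl | rfl | rfl | rfl | rfl | rfl | rfl | rfl <;>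
    exact norm_barlowPos_fcc_eq_one (by norm_num)

/-- Every slot is a site of `Λ₀`. -/
theorem mem_fcc_of_mem_fccSlots {w : EuclideanSpace ℝ (Fin 3)} (hw : w ∈ fccSlots) :
    w ∈ fccStacking 1 (Real.sqrt (2 / 3)) := by
  rw [fccSlots, mem_image] at hw
  obtain ⟨c, -, rfl⟩ := hw
  exact barlowPos_mem _ _ _

/-- `Λ₀` is closed under adding a slot. -/
theorem add_mem_fcc_of_mem_fccSlots {p w : EuclideanSpace ℝ (Fin 3)}
    (hp : p ∈ fccStacking 1 (Real.sqrt (2 / 3))) (hw : w ∈ fccSlots) :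
    p + w ∈ fccStacking 1 (Real.sqrt (2 / 3)) := by
  obtain ⟨k, i, j, rfl⟩ := hp
  rw [fccSlots, mem_image] at hw
  obtain ⟨c, -, rfl⟩ := hw
  refine ⟨k + c.1, i + c.2.1, j + c.2.2, ?_⟩
  have h := barlowPos_fcc_sub (k + c.1) (i + c.2.1) (j + c.2.2) c.1 c.2.1 c.2.2
  simp only [add_sub_cancel_right] at h
  rw [← h]; abel

/-- **Two sites at distance `1` differ by a slot.** -/
theorem sub_mem_fccSlots_of_dist_eq_one {p q : EuclideanSpace ℝ (Fin 3)}
    (hp : p ∈ fccStacking 1 (Real.sqrt (2 / 3))) (hq : q ∈ fccStacking 1 (Real.sqrt (2 / 3)))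
    (hd : dist p q = 1) : q - p ∈ fccSlots := by
  classical
  obtain ⟨c, hc, h⟩ := fcc_unit_directions p q hp hq hd
  rw [fccSlots, mem_image]
  simp only [List.mem_cons, List.mem_nil_iff, or_false] at hc
  rcases h with h | h
  · refine ⟨c, ?_, by rw [h]; abel⟩
    rcases hc with rfl | rfl | rfl | rfl | rfl | rfl <;> simp [fccSlotTriples]
  · refine ⟨(-c.1, -c.2.1, -c.2.2), ?_, ?_⟩
    · rcases hc with rfl | rfl | rfl | rfl | rfl | rfl <;> simp [fccSlotTriples]
    · have hneg : barlowPos 1 (Real.sqrt (2 / 3)) constHagg (-c.1) (-c.2.1) (-c.2.2) =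
          -barlowPos 1 (Real.sqrt (2 / 3)) constHagg c.1 c.2.1 c.2.2 := by
        have h0 := barlowPos_fcc_sub 0 0 0 c.1 c.2.1 c.2.2
        simp only [zero_sub] at h0
        rw [← h0, barlowPos_fcc_linear 1 _ 0 0 0]; simp
      simp only
      rw [hneg, h]; abel

/-- **Contacts = occupied slots.**  For `p ∈ Λ₀` and `P ⊆ Λ₀` finite:
`#{q ∈ P : dist p q = 1} = #{w ∈ fccSlots : p + w ∈ P}`. -/
theorem card_contacts_eq_card_occupied_slots (P : Finset (EuclideanSpace ℝ (Fin 3)))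
    (hP : ∀ q ∈ P, q ∈ fccStacking 1 (Real.sqrt (2 / 3))) (p : EuclideanSpace ℝ (Fin 3))
    (hp : p ∈ fccStacking 1 (Real.sqrt (2 / 3))) :
    (P.filter fun q => dist p q = 1).card = (fccSlots.filter fun w => p + w ∈ P).card := by
  classical
  refine card_nbij' (fun q => q - p) (fun w => p + w) (fun q hq => ?_) (fun w hw => ?_)
    (fun q _ => by simp) (fun w _ => by simp)
  · have hq' := mem_filter.1 (mem_coe.1 hq)
    refine mem_coe.2 (mem_filter.2 ⟨sub_mem_fccSlots_of_dist_eq_one hp (hP q hq'.1) hq'.2, ?_⟩)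
    rw [add_sub_cancel]; exact hq'.1
  · have hw' := mem_filter.1 (mem_coe.1 hw)
    refine mem_coe.2 (mem_filter.2 ⟨hw'.2, ?_⟩)
    rw [dist_eq_norm, sub_add_cancel_left, norm_neg, norm_eq_one_of_mem_fccSlots hw'.1]

/-- **The slot sum.**  For finite `P ⊆ Λ₀`:  `D(P) = ½ Σ_{w ∈ fccSlots} #{p ∈ P : p + w ∉ P}`. -/
theorem contactDeficiency_eq_half_sum_card_empty (P : Finset (EuclideanSpace ℝ (Fin 3)))
    (hP : ∀ q ∈ P, q ∈ fccStacking 1 (Real.sqrt (2 / 3))) :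
    contactDeficiency P =
      1 / 2 * ∑ w ∈ fccSlots, ((P.filter fun p => p + w ∉ P).card : ℝ) := by
  classical
  -- ordered contacts as a sum of occupied-slot counts
  have hord : (orderedContacts P : ℝ) = ∑ p ∈ P, ((fccSlots.filter fun w => p + w ∈ P).card : ℝ) := by
    rw [orderedContacts_eq_sum_sum]
    refine sum_congr rfl fun p hp => ?_
    rw [← card_contacts_eq_card_occupied_slots P hP p (hP p hp), card_filter, Nat.cast_sum]
    refine sum_congr rfl fun q _ => ?_
    split_ifs <;> simp
  -- occupied + empty = 12 at every site
  have hsplit : ∀ p ∈ P, ((fccSlots.filter fun w => p + w ∈ P).card : ℝ) +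
      ((fccSlots.filter fun w => p + w ∉ P).card : ℝ) = 12 := by
    intro p _
    have h := Finset.card_filter_add_card_filter_not (s := fccSlots) (fun w => p + w ∈ P)
    rw [card_fccSlots] at h
    exact_mod_cast h
  -- swap the double sum
  have hswap : ∑ w ∈ fccSlots, ((P.filter fun p => p + w ∉ P).card : ℝ) =
      ∑ p ∈ P, ((fccSlots.filter fun w => p + w ∉ P).card : ℝ) := by
    simp only [card_filter, Nat.cast_sum]
    rw [sum_comm]
  rw [hswap, contactDeficiency, hord]
  have h12 : ∑ p ∈ P, ((fccSlots.filter fun w => p + w ∉ P).card : ℝ) =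
      ∑ p ∈ P, (12 - ((fccSlots.filter fun w => p + w ∈ P).card : ℝ)) :=
    sum_congr rfl fun p hp => by linarith [hsplit p hp]
  rw [h12, sum_sub_distrib, sum_const, nsmul_eq_mul]
  ring

end Summit.Ventures.Crystal3D.Theorems

end
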